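import Summits.QuantumFields.YangMills.Theorems.FluctuationComparisonRegPrIntLS2BetaCriticalFamily
import Mathlib.Analysis.Matrix.PosDef
import Mathlib.Analysis.Calculus.FDeriv.Symmetric
import Mathlib.Analysis.Calculus.ContDiff.Deriv
import HarnessLib

/-!
# S2β · LAPLACE row — (DET-REP-A, (DET) rows): THE SLICE-HESSIAN MATRIX ALONG A NON-DEGENERATE CRITICAL FAMILY IS `C¹` AND POSITIVE DEFINITE (pen w5-20520 g14)

Cell `ym3-torus` (rung R3: continuum `SU(2)` Yang–Mills on `T³` — NOT `d = 4`, NOT infinite volume, NOT a mass gap, NOT Clay); width seat `ym-ust-20520-w5` g14;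
helper of the crux `stmt-QuantumFields-20520` (`--supports`, NOT a proof of it).  THEOREMS ONLY (0 `def`, 0 `sorry`; default heartbeats); generic calculus ∕ linear algebra.

WHY (FOUR-POINT-DECAY of LINE g18-1 v10.1; LINE-OWNER RULING (W3): v11 = DET-REP-A «(REP)+(DET) for the operators OF RECORD» — on the common-tube route
`M(s,t) :=` the matrix, in a fixed basis, of the slice Hessian of `(s, y) ↦ A(c.Φ(x(s,t), σ_U y))` at the moving minimiser coordinate `y(s,t)`).  px19's log-det
rectangle (✓p744587 ∕ ✓`…LogDetProductRows`) consumes, for such an `M`, the (DET) rows `HasDerivAt (fun s => M s i j) (M' s i j) s`, `Continuous (M' · i j)`,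
`(M s).det ≠ 0`.  THIS FILE produces them (in LOCAL form, on an open set of parameters) from the data DET-REP-A has: `f` of class `C³` (✓(C2′) p744240), a
continuous critical family `y` (✓ArgminGlue `tendsto_of_isMinOn_of_growth`), and positivity of the slice Hessian (GAP♯ ∘ (T2)).

WHAT.  §1 ★★ `contDiffAt_of_criticalFamily_at` — ✓IFT-min `contDiffAt_of_criticalFamily` (p745062) at an ARBITRARY base parameter `s₀` (translation).
§2 ★ `sliceHessian_symm` — the slice Hessian `((D[q ↦ Df(q) ∘ inr](q)) ∘ inr) v w` is symmetric in `(v, w)` where `f` is `C²` (Mathlib `ContDiffAt.isSymmSndFDerivAt`).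
§3 ★★★ `sliceHessian_detRows` — for `f : ℝ × E → ℝ` of class `C³` along a continuous critical family `y` on an open `I ⊆ ℝ` with positive slice Hessian, and any
basis `bι` of `E`: the matrix `M s i j := Hess(s) (bι i) (bι j)` has `C¹` entries on `I` (`HasDerivAt` with `deriv`, continuous on `I`), is positive definite, and
`0 < det (M s)`; and `y` is `C²` on `I`.

HONEST SCOPE.  Generic; proves no stub; FOUR-POINT-DECAY ∕ LAPLACE ∕ S2β ∕ the crux 20520 NOT proved; `YM3TorusSU2` NOT proved; the Yang–Mills mass gap (Clay) NOT proved.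

References: [Dieudonne1960] Ch. X §2 (10.2.1)–(10.2.3); [Balaban1985Variational] CMP 102 (1985) Thm 1 (8)–(10) p. 279, (142) p. 299.
-/

noncomputable section

open scoped Topology ContDiff Matrix
open Filter Set Function
open Summit.QuantumFields.YangMills.Theorems.FluctuationComparisonRegPrIntLS2BetaCriticalFamily

namespace Summit.QuantumFields.YangMills.Theorems.FluctuationComparisonRegPrIntLS2BetaHessianDetRows

variable {S E : Type*} [NormedAddCommGroup S] [NormedSpace ℝ S] [NormedAddCommGroup E] [NormedSpace ℝ E]

/-! ## §1 IFT-min at an arbitrary base parameter -/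

/-- ★★ **(IFT-min at `s₀`)** ✓`contDiffAt_of_criticalFamily` transported to an arbitrary base parameter: if `f` is `C^{n+1}` at `(s₀, y s₀)`, `y` is continuous at `s₀`,
`D(f(s,·))(y s) = 0` for `s` near `s₀`, and the slice Hessian at `(s₀, y s₀)` is invertible, then `y` is `C^n` at `s₀`. (Translation `q ↦ (s₀, 0) + q`,
`fderiv_comp_add_left`.) [cite: Dieudonne1960, Ch. X §2 (10.2.1)–(10.2.3)] -/
theorem contDiffAt_of_criticalFamily_at [CompleteSpace S] [CompleteSpace E] {f : S × E → ℝ} {y : S → E} {s₀ : S} {n : WithTop ℕ∞} (hn : n ≠ 0)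
    (hf : ContDiffAt ℝ (n + 1) f (s₀, y s₀))
    (hcrit : ∀ᶠ s in 𝓝 s₀, fderiv ℝ (fun e => f (s, e)) (y s) = 0)
    (hy : ContinuousAt y s₀)
    (hH : ((fderiv ℝ (fun q : S × E => (fderiv ℝ f q).comp (ContinuousLinearMap.inr ℝ S E)) (s₀, y s₀)).comp
      (ContinuousLinearMap.inr ℝ S E)).IsInvertible) :
    ContDiffAt ℝ n y s₀ := by
  set a : S × E := (s₀, 0) with ha
  set g : S × E → ℝ := fun q => f (a + q) with hg
  set z : S → E := fun s => y (s₀ + s) with hz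
  have haq : ∀ (s : S) (e : E), a + (s, e) = (s₀ + s, e) := fun s e => by simp [ha]
  have hz0 : z 0 = y s₀ := by simp [hz]
  have ha0 : a + (0, z 0) = (s₀, y s₀) := by rw [haq, add_zero, hz0]
  have htr : ContDiffAt ℝ (n + 1) (fun q : S × E => a + q) (0, z 0) := contDiffAt_const.add contDiffAt_id
  have hg' : ContDiffAt ℝ (n + 1) g (0, z 0) := by
    have hf' : ContDiffAt ℝ (n + 1) f (a + (0, z 0)) := by rw [ha0]; exact hf
    exact hf'.comp (0, z 0) htr
  have hfd : ∀ q, fderiv ℝ g q = fderiv ℝ f (a + q) := fun q => fderiv_comp_add_left a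
  have ht : Tendsto (fun s : S => s₀ + s) (𝓝 0) (𝓝 s₀) :=
    (show Continuous (fun s : S => s₀ + s) from continuous_const.add continuous_id).tendsto' 0 s₀ (add_zero s₀)
  have hcrit' : ∀ᶠ s in 𝓝 (0 : S), fderiv ℝ (fun e => g (s, e)) (z s) = 0 := by
    filter_upwards [ht.eventually hcrit] with s hs
    have hfun : (fun e => g (s, e)) = fun e => f (s₀ + s, e) := by funext e; simp only [hg, haq]
    rw [hfun]; exact hs
  have hz' : ContinuousAt z 0 := by
    have hy' : ContinuousAt y (s₀ + 0) := by rw [add_zero]; exact hy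
    exact hy'.comp (continuousAt_const.add continuousAt_id)
  set Φf : S × E → E →L[ℝ] ℝ := fun q' => (fderiv ℝ f q').comp (ContinuousLinearMap.inr ℝ S E) with hΦf
  have hΦ : (fun q : S × E => (fderiv ℝ g q).comp (ContinuousLinearMap.inr ℝ S E)) = fun q => Φf (a + q) := by
    funext q; simp only [hΦf, hfd]
  have hfdΦ : fderiv ℝ (fun q => Φf (a + q)) (0, z 0) = fderiv ℝ Φf (a + (0, z 0)) := fderiv_comp_add_left a
  have hH' : ((fderiv ℝ (fun q : S × E => (fderiv ℝ g q).comp (ContinuousLinearMap.inr ℝ S E)) (0, z 0)).comp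
      (ContinuousLinearMap.inr ℝ S E)).IsInvertible := by
    rw [hΦ, hfdΦ, ha0]; exact hH
  have hzn : ContDiffAt ℝ n z 0 := contDiffAt_of_criticalFamily hn hg' hcrit' hz' hH'
  have hyz : y = z ∘ fun s => s - s₀ := by funext s; simp [hz]
  rw [hyz]
  refine ContDiffAt.comp s₀ ?_ (contDiffAt_id.sub contDiffAt_const)
  rw [sub_self]; exact hzn

/-! ## §2 The slice Hessian is symmetric -/

/-- ★ **THE SLICE HESSIAN IS SYMMETRIC** where `f` is `C²`: `((D[q ↦ Df(q) ∘ inr](q)) ∘ inr) v w = (same) w v` — it is `D²f(q)(inr v)(inr w)`, symmetric by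
Mathlib `ContDiffAt.isSymmSndFDerivAt`. [cite: Dieudonne1960, Ch. X §2 (10.2.3) (bookkeeping)] -/
theorem sliceHessian_symm {f : S × E → ℝ} {q : S × E} (hf : ContDiffAt ℝ 2 f q) (v w : E) :
    ((fderiv ℝ (fun q' : S × E => (fderiv ℝ f q').comp (ContinuousLinearMap.inr ℝ S E)) q).comp (ContinuousLinearMap.inr ℝ S E)) v w =
      ((fderiv ℝ (fun q' : S × E => (fderiv ℝ f q').comp (ContinuousLinearMap.inr ℝ S E)) q).comp (ContinuousLinearMap.inr ℝ S E)) w v := by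
  set L : (S × E →L[ℝ] ℝ) →L[ℝ] (E →L[ℝ] ℝ) := (ContinuousLinearMap.compL ℝ E (S × E) ℝ).flip (ContinuousLinearMap.inr ℝ S E) with hL_def
  have hL : ∀ T : S × E →L[ℝ] ℝ, L T = T.comp (ContinuousLinearMap.inr ℝ S E) := fun T => by simp [hL_def]
  have hd : DifferentiableAt ℝ (fderiv ℝ f) q :=
    ((hf.fderiv_right (m := 1) (by norm_num)).differentiableAt (by simp))
  have hfun : (fun q' : S × E => (fderiv ℝ f q').comp (ContinuousLinearMap.inr ℝ S E)) = fun q' => L (fderiv ℝ f q') := by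
    funext q'; rw [hL]
  have hchain : fderiv ℝ (fun q' : S × E => L (fderiv ℝ f q')) q = L.comp (fderiv ℝ (fderiv ℝ f) q) :=
    (L.hasFDerivAt.comp q hd.hasFDerivAt).fderiv
  have hsym := hf.isSymmSndFDerivAt (by simp) (ContinuousLinearMap.inr ℝ S E v) (ContinuousLinearMap.inr ℝ S E w)
  rw [hfun, hchain]
  simp only [ContinuousLinearMap.comp_apply, hL]
  exact hsym

/-! ## §3 The (DET) rows of the slice-Hessian matrix along the family -/

/-- ★★★ **THE (DET) ROWS OF DET-REP-A, LOCAL FORM.**  `f : ℝ × E → ℝ` (`E` real Banach, finite-dimensional with a basis `bι`), `y : ℝ → E`, `I ⊆ ℝ` open;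
on `I`: `f` is `C³` at `(s, y s)`, `y` is continuous, `D(f(s,·))(y s) = 0`, and the slice Hessian `H(s)` at `(s, y s)` is positive (`0 < H(s) v v` for `v ≠ 0`).
Then with `M s i j := H(s) (bι i) (bι j)`: (i) `y` is `C²` on `I`; (ii) every entry `s ↦ M s i j` is `C¹` on `I`, with `HasDerivAt … (deriv … s) s` and
`deriv` continuous on `I`; (iii) `M s` is positive definite and `0 < det (M s)` — px19's `hM ∕ hM'c ∕ hne` rows (local edition) and the sign for `log det`.
[cite: Dieudonne1960, Ch. X §2 (10.2.1)–(10.2.3)] [cite: Balaban1985Variational, (142) p.299 (bookkeeping)] -/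
theorem sliceHessian_detRows [CompleteSpace E] [FiniteDimensional ℝ E] {ι : Type*} [Fintype ι] [DecidableEq ι] (bι : Module.Basis ι ℝ E)
    {f : ℝ × E → ℝ} {y : ℝ → E} {I : Set ℝ} (hI : IsOpen I)
    (hf : ∀ s ∈ I, ContDiffAt ℝ 3 f (s, y s))
    (hcrit : ∀ s ∈ I, fderiv ℝ (fun e => f (s, e)) (y s) = 0)
    (hy : ∀ s ∈ I, ContinuousAt y s)
    (hpos : ∀ s ∈ I, ∀ v : E, v ≠ 0 →
      0 < ((fderiv ℝ (fun q : ℝ × E => (fderiv ℝ f q).comp (ContinuousLinearMap.inr ℝ ℝ E)) (s, y s)).comp (ContinuousLinearMap.inr ℝ ℝ E)) v v) :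
    (∀ s ∈ I, ContDiffAt ℝ 2 y s) ∧
    (∀ i j, ContDiffOn ℝ 1 (fun s => ((fderiv ℝ (fun q : ℝ × E => (fderiv ℝ f q).comp (ContinuousLinearMap.inr ℝ ℝ E)) (s, y s)).comp
      (ContinuousLinearMap.inr ℝ ℝ E)) (bι i) (bι j)) I) ∧
    (∀ s ∈ I, ∀ i j, HasDerivAt (fun s => ((fderiv ℝ (fun q : ℝ × E => (fderiv ℝ f q).comp (ContinuousLinearMap.inr ℝ ℝ E)) (s, y s)).comp
      (ContinuousLinearMap.inr ℝ ℝ E)) (bι i) (bι j))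
      (deriv (fun s => ((fderiv ℝ (fun q : ℝ × E => (fderiv ℝ f q).comp (ContinuousLinearMap.inr ℝ ℝ E)) (s, y s)).comp
        (ContinuousLinearMap.inr ℝ ℝ E)) (bι i) (bι j)) s) s) ∧
    (∀ i j, ContinuousOn (deriv (fun s => ((fderiv ℝ (fun q : ℝ × E => (fderiv ℝ f q).comp (ContinuousLinearMap.inr ℝ ℝ E)) (s, y s)).comp
      (ContinuousLinearMap.inr ℝ ℝ E)) (bι i) (bι j))) I) ∧
    (∀ s ∈ I, (Matrix.of fun i j => ((fderiv ℝ (fun q : ℝ × E => (fderiv ℝ f q).comp (ContinuousLinearMap.inr ℝ ℝ E)) (s, y s)).comp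
      (ContinuousLinearMap.inr ℝ ℝ E)) (bι i) (bι j)).PosDef) ∧
    (∀ s ∈ I, 0 < (Matrix.of fun i j => ((fderiv ℝ (fun q : ℝ × E => (fderiv ℝ f q).comp (ContinuousLinearMap.inr ℝ ℝ E)) (s, y s)).comp
      (ContinuousLinearMap.inr ℝ ℝ E)) (bι i) (bι j)).det) := by
  -- abbreviations (terms, not defs)
  set Φ : ℝ × E → E →L[ℝ] ℝ := fun q => (fderiv ℝ f q).comp (ContinuousLinearMap.inr ℝ ℝ E) with hΦ
  set H : ℝ → E →L[ℝ] (E →L[ℝ] ℝ) := fun s => (fderiv ℝ Φ (s, y s)).comp (ContinuousLinearMap.inr ℝ ℝ E) with hH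
  have h21 : (2 : WithTop ℕ∞) + 1 = 3 := by norm_num
  -- (i) `y` is `C²` on `I`
  have hyC2 : ∀ s ∈ I, ContDiffAt ℝ 2 y s := by
    intro s hs
    have hcr : ∀ᶠ s' in 𝓝 s, fderiv ℝ (fun e => f (s', e)) (y s') = 0 :=
      Filter.eventually_of_mem (hI.mem_nhds hs) fun s' hs' => hcrit s' hs'
    have hf2 : ContDiffAt ℝ (2 + 1) f (s, y s) := by rw [h21]; exact hf s hs
    exact contDiffAt_of_criticalFamily_at two_ne_zero hf2 hcr (hy s hs) (isInvertible_of_forall_pos _ (hpos s hs))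
  -- the operator family `s ↦ D Φ (s, y s)` is `C¹` on `I`
  have hDΦC1 : ∀ s ∈ I, ContDiffAt ℝ 1 (fun s : ℝ => fderiv ℝ Φ (s, y s)) s := by
    intro s hs
    have hΦ2 : ContDiffAt ℝ 2 Φ (s, y s) := by
      have hf2 : ContDiffAt ℝ (2 + 1) f (s, y s) := by rw [h21]; exact hf s hs
      exact contDiffAt_partialFDeriv hf2
    have hDΦ : ContDiffAt ℝ 1 (fderiv ℝ Φ) (s, y s) := hΦ2.fderiv_right (m := 1) (by norm_num)
    have hpair : ContDiffAt ℝ 1 (fun s : ℝ => ((s : ℝ), y s)) s := (contDiffAt_id.prodMk (hyC2 s hs)).of_le (by norm_num)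
    exact hDΦ.comp s hpair
  -- the entries are `C¹` on `I`
  have hent : ∀ i j, ∀ s ∈ I, ContDiffAt ℝ 1 (fun s => H s (bι i) (bι j)) s := by
    intro i j s hs
    have h1 : ContDiffAt ℝ 1 (fun s : ℝ => (fderiv ℝ Φ (s, y s)) (ContinuousLinearMap.inr ℝ ℝ E (bι i)) (bι j)) s :=
      ((hDΦC1 s hs).clm_apply contDiffAt_const).clm_apply contDiffAt_const
    exact h1
  have hOn : ∀ i j, ContDiffOn ℝ 1 (fun s => H s (bι i) (bι j)) I := fun i j s hs => (hent i j s hs).contDiffWithinAt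
  have hDer : ∀ s ∈ I, ∀ i j, HasDerivAt (fun s => H s (bι i) (bι j)) (deriv (fun s => H s (bι i) (bι j)) s) s :=
    fun s hs i j => ((hent i j s hs).differentiableAt (by simp)).hasDerivAt
  have hDerC : ∀ i j, ContinuousOn (deriv (fun s => H s (bι i) (bι j))) I := by
    intro i j
    have h := (contDiffOn_succ_iff_deriv_of_isOpen (𝕜 := ℝ) (n := 0) hI).1 (by simpa using hOn i j)
    exact h.2.2.continuousOn
  -- positive definiteness of the matrix
  have hPD : ∀ s ∈ I, (Matrix.of fun i j => H s (bι i) (bι j)).PosDef := by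
    intro s hs
    have hf2 : ContDiffAt ℝ 2 f (s, y s) := (hf s hs).of_le (by norm_num)
    refine Matrix.posDef_iff_dotProduct_mulVec.2 ⟨?_, ?_⟩
    · -- Hermitian = symmetric
      ext i j
      simp only [Matrix.conjTranspose_apply, Matrix.of_apply, star_trivial]
      exact sliceHessian_symm hf2 (bι j) (bι i)
    · intro x hx
      set v : E := ∑ i, x i • bι i with hv
      have hv0 : v ≠ 0 := by
        intro h0
        apply hx
        have hrepr : (bι.repr v : ι → ℝ) = x := by rw [hv]; exact bι.repr_sum_self x
        funext i
        have := congrFun hrepr i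
        rw [h0, map_zero] at this
        simpa using this.symm
      have hHv : ∀ w : E, H s v w = ∑ i, x i * H s (bι i) w := by
        intro w
        have h1 : H s v = ∑ i, x i • H s (bι i) := by simp only [hv, map_sum, map_smul]
        rw [h1, FunLike.coe_sum, Finset.sum_apply]
        refine Finset.sum_congr rfl fun i _ => ?_
        rw [FunLike.coe_smul, Pi.smul_apply, smul_eq_mul]
      have hHw : ∀ i, H s (bι i) v = ∑ j, x j * H s (bι i) (bι j) := by
        intro i; simp only [hv, map_sum, map_smul, smul_eq_mul]
      have hq : star x ⬝ᵥ ((Matrix.of fun i j => H s (bι i) (bι j)) *ᵥ x) = H s v v := by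
        rw [hHv]
        simp only [dotProduct, Matrix.mulVec, Matrix.of_apply, star_trivial, hHw]
        refine Finset.sum_congr rfl fun i _ => ?_
        congr 1
        exact Finset.sum_congr rfl fun j _ => mul_comm _ _
      rw [hq]
      exact hpos s hs v hv0
  refine ⟨hyC2, hOn, hDer, hDerC, hPD, fun s hs => (hPD s hs).det_pos⟩

end Summit.QuantumFields.YangMills.Theorems.FluctuationComparisonRegPrIntLS2BetaHessianDetRows

end
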